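import Summits.Ventures.Crystal3D.Theorems.StickyWulffConstantNoReconstructionGainJointBoundAzimuth
import Literature.Geometry.DiscreteGeometry.SphericalCodeContactGraph
import HarnessLib

/-!
# Joint level/support bound — the deep-heavy rows (line `joint-level-support-bound`)

HONEST FRAMING. Part of the venture `Summits/Ventures/Crystal3D` (cell `crystal3d-full`), supports the
crux `NoReconstructionGain` (stmt-Ventures-19144, route `route-Ventures-StickyWulffConstant`), line
`joint-level-support-bound` (skeleton `Cruxes/NoReconstructionGain/Lines/joint_level_support_bound.lean`).
THE REGISTERED STUB `stub_jointBound_deepHeavy`, by name: for a unit normal `ν` and a finite set `U` of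
unit vectors with pairwise inner products `≤ 1/2` (contact directions of one ball), if at least five
directions are `1/2`-deep (`⟪u, ν⟫ ≤ -1/2`) then `2·#deep + #level ≤ 12`, level meaning
`|⟪u, ν⟫| ≤ 1/10`.  Rows (≥ 7 deep), (6 deep, ≥ 1 level), (5 deep, ≥ 3 level) of the joint table are
empty; (110) realises (5, 2), the pole plus a pentagon realises (6, 0).

Method (azimuthal gaps about `ν`, `…JointBoundAzimuth`, `…JointBoundTrig`): POLE CASE (`-ν ∈ U`):
the other deep directions are pinned to `⟪u, ν⟫ = -1/2` and the weighted azimuthal cycle (weights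
`0.614` pinned / `0.258` level; gaps `> 1.228`, `0.872`, `0.516`) contradicts `2·#deep + #level ≥ 13`;
NO POLE: six deep directions have gaps `> 1.05 > 2π/6`; five deep plus a level `ℓ`: the chain of
azimuths measured from `ℓ` (`chain_five_deep_level_false`, bands at depths `0.682` / `0.602`).

WHAT THIS IS NOT: the level-heavy row (`stub_jointBound_levelHeavy`), nor the crux; rung F-C1 not moved.
-/

noncomputable section

namespace Summit.Ventures.Crystal3D.Theorems

open Finset Real
open Literature.Geometry.DiscreteGeometry (exists_orthonormalBasis_third_eq_unit)
open Literature.Algebra.EuclideanLattices (inner_fin_three norm_sq_fin_three)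
open scoped InnerProductSpace

/-! ### The five-deep chain (pure bookkeeping) -/

/-- **Five deep directions and one level direction cannot coexist (no pole).**  Pure bookkeeping of
the azimuthal chain measured from the level direction: `t 0 ≤ … ≤ t 4` are the azimuths of the deep
directions in `[0, 2π)`, `z i` their heights; the hypotheses are the certified arc bounds (every deep
gap `> 1.228`; `> 1.3125` next to a direction deeper than `0.682`; `> 1.2741` next to one deeper than
`0.602`; level clearance `> 0.6702` from a direction at most `0.682` deep, `> 0.7837` from one at
most `0.602` deep). -/
theorem chain_five_deep_level_false (t z : ℕ → ℝ)
    (hmono : ∀ i j, i ≤ j → j < 5 → t i ≤ t j) (h0 : 0 ≤ t 0) (h4 : t 4 < 2 * π)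
    (hdd : ∀ i j, i < 5 → j < 5 → i ≠ j → ∀ x, 0 ≤ x → Real.cos x = Real.cos (t i - t j) →
      1.228 < x)
    (hD : ∀ i j, i < 5 → j < 5 → i ≠ j → z i < -0.682 → ∀ x, 0 ≤ x →
      Real.cos x = Real.cos (t i - t j) → 1.3125 < x)
    (hM : ∀ i j, i < 5 → j < 5 → i ≠ j → z i < -0.602 → ∀ x, 0 ≤ x →
      Real.cos x = Real.cos (t i - t j) → 1.2741 < x)
    (hcM : ∀ i, i < 5 → -0.682 ≤ z i → ∀ x, 0 ≤ x → Real.cos x = Real.cos (t i) → 0.6702 < x)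
    (hcS : ∀ i, i < 5 → -0.602 ≤ z i → ∀ x, 0 ≤ x → Real.cos x = Real.cos (t i) → 0.7837 < x) :
    False := by
  have hpi := Real.pi_lt_d4
  have hcos_symm : ∀ a b : ℝ, Real.cos (a - b) = Real.cos (b - a) := fun a b => by
    rw [← Real.cos_neg, neg_sub]
  have h01 := hmono 0 1 (by omega) (by omega)
  have h12 := hmono 1 2 (by omega) (by omega)
  have h23 := hmono 2 3 (by omega) (by omega)
  have h34 := hmono 3 4 (by omega) (by omega)
  have g01 := hdd 1 0 (by omega) (by omega) (by omega) (t 1 - t 0) (by linarith) rfl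
  have g12 := hdd 2 1 (by omega) (by omega) (by omega) (t 2 - t 1) (by linarith) rfl
  have g23 := hdd 3 2 (by omega) (by omega) (by omega) (t 3 - t 2) (by linarith) rfl
  have g34 := hdd 4 3 (by omega) (by omega) (by omega) (t 4 - t 3) (by linarith) rfl
  have hcwrap : Real.cos (2 * π - (t 4 - t 0)) = Real.cos (t 4 - t 0) := Real.cos_two_pi_sub _
  have hxwrap : 0 ≤ 2 * π - (t 4 - t 0) := by linarith
  by_cases hq0D : z 0 < -0.682
  · have hspan := hD 0 4 (by omega) (by omega) (by omega) hq0D _ hxwrap (by rw [hcwrap, hcos_symm])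
    have g01' := hD 0 1 (by omega) (by omega) (by omega) hq0D (t 1 - t 0) (by linarith)
      (by rw [hcos_symm])
    linarith
  by_cases hq4D : z 4 < -0.682
  · have hspan := hD 4 0 (by omega) (by omega) (by omega) hq4D _ hxwrap hcwrap
    have g34' := hD 4 3 (by omega) (by omega) (by omega) hq4D (t 4 - t 3) (by linarith) rfl
    linarith
  push Not at hq0D hq4D
  have hF0 : 1.9443 < t 1 := by
    by_cases hq0M : z 0 < -0.602
    · have c0 := hcM 0 (by omega) hq0D (t 0) h0 rfl
      have a0 := hM 0 1 (by omega) (by omega) (by omega) hq0M (t 1 - t 0) (by linarith)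
        (by rw [hcos_symm])
      linarith
    · push Not at hq0M
      have c0 := hcS 0 (by omega) hq0M (t 0) h0 rfl
      linarith
  have hF4 : 1.9443 < 2 * π - t 3 := by
    have hx4 : 0 ≤ 2 * π - t 4 := by linarith
    have hc4 : Real.cos (2 * π - t 4) = Real.cos (t 4) := Real.cos_two_pi_sub _
    by_cases hq4M : z 4 < -0.602
    · have c4 := hcM 4 (by omega) hq4D _ hx4 hc4
      have a4 := hM 4 3 (by omega) (by omega) (by omega) hq4M (t 4 - t 3) (by linarith) rfl
      linarith
    · push Not at hq4M
      have c4 := hcS 4 (by omega) hq4M _ hx4 hc4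
      linarith
  linarith

/-! ### The coordinate form -/

/-- **Deep-heavy rows, coordinate form.**  `F` a finite set of unit vectors of `ℝ³` with pairwise
inner products `≤ 1/2`; deep = third coordinate `≤ -1/2`, level = third coordinate in `[-1/10, 1/10]`.
If `#deep ≥ 5` then `2·#deep + #level ≤ 12`. -/
theorem jointBound_deepHeavy_coord (F : Finset (EuclideanSpace ℝ (Fin 3)))
    (hn : ∀ u ∈ F, ‖u‖ = 1) (hsep : ∀ u ∈ F, ∀ v ∈ F, u ≠ v → ⟪u, v⟫_ℝ ≤ 1 / 2)
    (h5 : 5 ≤ (F.filter fun u => u 2 ≤ -(1 / 2)).card) :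
    2 * (F.filter fun u => u 2 ≤ -(1 / 2)).card + (F.filter fun u => |u 2| ≤ 1 / 10).card ≤ 12 := by
  classical
  set D := F.filter fun u => u 2 ≤ -(1 / 2) with hD
  set L := F.filter fun u => |u 2| ≤ 1 / 10 with hL
  have hpi := Real.pi_lt_d4
  have hpi3 := Real.pi_gt_three
  have hmemD : ∀ u ∈ D, u ∈ F ∧ u 2 ≤ -(1 / 2) := fun u hu => by simpa [hD] using hu
  have hmemL : ∀ u ∈ L, u ∈ F ∧ |u 2| ≤ 1 / 10 := fun u hu => by simpa [hL] using hu
  have hnotL : ∀ u ∈ D, ¬ |u 2| ≤ 1 / 10 := fun u hu h => by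
    have := (hmemD u hu).2; have h' := (abs_le.1 h).1; linarith
  have hDL : Disjoint D L := disjoint_left.2 fun u huD huL => hnotL u huD (hmemL u huL).2
  have hco : ∀ u ∈ F, u 0 ^ 2 + u 1 ^ 2 + u 2 ^ 2 = 1 := fun u hu => by
    rw [← norm_sq_fin_three, hn u hu]; norm_num
  by_contra H
  push Not at H
  -- the pair constraint in azimuthal form, for any azimuth data
  have hpair : ∀ (ρ θ : EuclideanSpace ℝ (Fin 3) → ℝ),
      (∀ u, 0 ≤ ρ u ∧ ρ u ^ 2 = u 0 ^ 2 + u 1 ^ 2) →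
      (∀ u v, ρ u * ρ v * Real.cos (θ u - θ v) = u 0 * v 0 + u 1 * v 1) →
      ∀ u ∈ F, ∀ v ∈ F, u ≠ v → ∀ x : ℝ, Real.cos x = Real.cos (θ u - θ v) →
        ρ u * ρ v * Real.cos x + u 2 * v 2 ≤ 1 / 2 := by
    intro ρ θ hρ hθ u hu v hv huv x hx
    rw [hx, hθ u v, ← inner_fin_three]
    exact hsep u hu v hv huv
  have hzρ : ∀ (ρ : EuclideanSpace ℝ (Fin 3) → ℝ), (∀ u, 0 ≤ ρ u ∧ ρ u ^ 2 = u 0 ^ 2 + u 1 ^ 2) →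
      ∀ u ∈ F, u 2 ^ 2 + ρ u ^ 2 = 1 := fun ρ hρ u hu => by rw [(hρ u).2]; linarith [hco u hu]
  by_cases hpole : ∃ u₀ ∈ D, u₀ 0 ^ 2 + u₀ 1 ^ 2 = 0
  · /- POLE CASE -/
    obtain ⟨u₀, hu₀D, hu₀⟩ := hpole
    have hu₀F := (hmemD u₀ hu₀D).1
    have hx0 : u₀ 0 = 0 := by nlinarith [sq_nonneg (u₀ 0), sq_nonneg (u₀ 1)]
    have hy0 : u₀ 1 = 0 := by nlinarith [sq_nonneg (u₀ 0), sq_nonneg (u₀ 1)]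
    have hz0 : u₀ 2 = -1 := by
      have h1 := hco u₀ hu₀F
      have h2 := (hmemD u₀ hu₀D).2
      nlinarith
    set D' := D.erase u₀ with hD'
    have hD'card : D'.card = D.card - 1 := card_erase_of_mem hu₀D
    have hpin : ∀ v ∈ D', v ∈ F ∧ v 2 = -(1 / 2) := by
      intro v hv
      have hvD : v ∈ D := mem_of_mem_erase hv
      have hne : u₀ ≠ v := (ne_of_mem_erase hv).symm
      have h := hsep u₀ hu₀F v (hmemD v hvD).1 hne
      rw [inner_fin_three, hx0, hy0, hz0] at h
      exact ⟨(hmemD v hvD).1, by linarith [(hmemD v hvD).2]⟩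
    have hD'4 : 4 ≤ D'.card := by rw [hD'card]; omega
    obtain ⟨p, hp⟩ : D'.Nonempty := card_pos.1 (by omega)
    have hpF := (hpin p hp).1
    have hpz := (hpin p hp).2
    have hpρ : 0 < p 0 ^ 2 + p 1 ^ 2 := by nlinarith [hco p hpF]
    obtain ⟨ρ, θ, hρ, hθ, hθp, -, hθpair⟩ := exists_azimuth p hpρ
    set T := (D'.erase p) ∪ L with hT
    have hpT : p ∉ T := by
      rw [hT, mem_union, not_or]
      exact ⟨notMem_erase p D', fun h => hnotL p (mem_of_mem_erase hp) (hmemL p h).2⟩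
    have hTne : T.Nonempty := by
      have : 3 ≤ (D'.erase p).card := by rw [card_erase_of_mem hp]; omega
      obtain ⟨v, hv⟩ : (D'.erase p).Nonempty := card_pos.1 (by omega)
      exact ⟨v, mem_union_left _ hv⟩
    have hmemT : ∀ u ∈ insert p T, u ∈ D' ∨ u ∈ L := by
      intro u hu
      rcases mem_insert.1 hu with rfl | hu
      · exact Or.inl hp
      · rcases mem_union.1 hu with hu | hu
        · exact Or.inl (mem_of_mem_erase hu)
        · exact Or.inr hu
    -- weights
    let w : EuclideanSpace ℝ (Fin 3) → ℝ := fun u => if |u 2| ≤ 1 / 10 then 0.258 else 0.614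
    have hwD : ∀ u ∈ D', w u = 0.614 := fun u hu => by
      show (if |u 2| ≤ 1 / 10 then (0.258 : ℝ) else 0.614) = 0.614
      rw [if_neg (hnotL u (mem_of_mem_erase hu))]
    have hwL : ∀ u ∈ L, w u = 0.258 := fun u hu => by
      show (if |u 2| ≤ 1 / 10 then (0.258 : ℝ) else 0.614) = 0.258
      rw [if_pos (hmemL u hu).2]
    have key := weighted_cycle_finset p T hTne hpT θ w hθp hθ ?_
    · -- evaluate the weights and conclude
      have hsum : ∑ u ∈ T, w u = 0.614 * ((D'.erase p).card : ℝ) + 0.258 * (L.card : ℝ) := by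
        rw [hT, sum_union (disjoint_of_subset_left ((erase_subset _ _).trans (erase_subset _ _)) hDL)]
        rw [sum_congr rfl fun u hu => hwD u (mem_of_mem_erase hu), sum_congr rfl fun u hu => hwL u hu]
        simp [sum_const, nsmul_eq_mul, mul_comm]
      rw [hsum, hwD p hp, card_erase_of_mem hp] at key
      have hDc : 5 ≤ D.card := h5
      have hcast : ((D'.card - 1 : ℕ) : ℝ) = (D.card : ℝ) - 2 := by
        rw [Nat.cast_sub (by omega), hD'card, Nat.cast_sub (by omega)]; push_cast; ring
      rw [hcast] at key
      by_cases h7 : 7 ≤ D.card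
      · have : (7 : ℝ) ≤ D.card := by exact_mod_cast h7
        have hL0 : (0 : ℝ) ≤ L.card := Nat.cast_nonneg _
        nlinarith
      · have hH : (13 : ℝ) ≤ 2 * D.card + L.card := by exact_mod_cast H
        have h56 : (D.card : ℝ) ≤ 6 := by exact_mod_cast (by omega : D.card ≤ 6)
        have h5' : (5 : ℝ) ≤ D.card := by exact_mod_cast hDc
        nlinarith
    · -- the gap bounds
      intro u hu v hv huv x hx hcx
      have huF : u ∈ F := by
        rcases hmemT u hu with h | h
        · exact (hpin u h).1
        · exact (hmemL u h).1
      have hvF : v ∈ F := by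
        rcases hmemT v hv with h | h
        · exact (hpin v h).1
        · exact (hmemL v h).1
      have hs := hpair ρ θ hρ hθpair u huF v hvF huv x hcx
      have hs' : ρ v * ρ u * Real.cos x + v 2 * u 2 ≤ 1 / 2 := by linarith
      have h1u := hzρ ρ hρ u huF
      have h1v := hzρ ρ hρ v hvF
      rcases hmemT u hu with huD | huL <;> rcases hmemT v hv with hvD | hvL
      · -- deep–deep (pinned)
        rw [hwD u huD, hwD v hvD]
        have hρu : 0 < ρ u := by
          have := (hρ u).2; have hz := (hpin u huD).2
          nlinarith [(hρ u).1, h1u]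
        have hρv : 0 < ρ v := by
          have hz := (hpin v hvD).2
          nlinarith [(hρ v).1, h1v]
        have := arc_gt_deep_deep 0.336 1.228 (1 / 2) (u 2) (v 2) (ρ u) (ρ v) x (by norm_num)
          cos_tdd_gt (by linarith) (by norm_num) (by norm_num) (by linarith [(hpin u huD).2])
          (by linarith [(hpin v hvD).2]) hρu hρv h1u h1v hx hs
        linarith
      · -- deep–level
        rw [hwD u huD, hwL v hvL]
        have := arc_gt_deep_level 0.6418 0.872 (1 / 2) (u 2) (v 2) (ρ u) (ρ v) x (by norm_num)
          cos_tdl_gt (by linarith) (by norm_num) (by linarith [(hpin u huD).2])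
          (by linarith [(hpin u huD).2]) (hmemL v hvL).2 (hρ u).1 (hρ v).1 h1u h1v hx hs
        linarith
      · -- level–deep
        rw [hwL u huL, hwD v hvD]
        have := arc_gt_deep_level 0.6418 0.872 (1 / 2) (v 2) (u 2) (ρ v) (ρ u) x (by norm_num)
          cos_tdl_gt (by linarith) (by norm_num) (by linarith [(hpin v hvD).2])
          (by linarith [(hpin v hvD).2]) (hmemL u huL).2 (hρ v).1 (hρ u).1 h1v h1u hx hs'
        linarith
      · -- level–level
        rw [hwL u huL, hwL v hvL]
        have := arc_gt_level_level 0.86 0.516 (u 2) (v 2) (ρ u) (ρ v) x (by norm_num)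
          cos_tll_gt (by linarith) (hmemL u huL).2 (hmemL v hvL).2 (hρ u).1 (hρ v).1 h1u h1v hx hs
        linarith
  · /- NO POLE -/
    push Not at hpole
    have hρpos : ∀ (ρ : EuclideanSpace ℝ (Fin 3) → ℝ), (∀ u, 0 ≤ ρ u ∧ ρ u ^ 2 = u 0 ^ 2 + u 1 ^ 2) →
        ∀ u ∈ D, 0 < ρ u := by
      intro ρ hρ u hu
      have hne := hpole u hu
      have hnn : 0 ≤ u 0 ^ 2 + u 1 ^ 2 := by positivity
      have hpos : 0 < u 0 ^ 2 + u 1 ^ 2 := lt_of_le_of_ne hnn (Ne.symm hne)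
      have h0 := (hρ u).1
      have h2 := (hρ u).2
      by_contra hle
      have : ρ u = 0 := le_antisymm (not_lt.1 hle) h0
      rw [this] at h2; simp at h2; linarith
    by_cases h6 : 6 ≤ D.card
    · /- six deep directions without the pole -/
      obtain ⟨D6, hD6, hD6card⟩ := exists_subset_card_eq h6
      obtain ⟨p, hp⟩ : D6.Nonempty := card_pos.1 (by omega)
      have hpD : p ∈ D := hD6 hp
      have hpF := (hmemD p hpD).1
      have hpρ : 0 < p 0 ^ 2 + p 1 ^ 2 :=
        lt_of_le_of_ne (by positivity) (Ne.symm (hpole p hpD))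
      obtain ⟨ρ, θ, hρ, hθ, hθp, -, hθpair⟩ := exists_azimuth p hpρ
      set T := D6.erase p with hT
      have hTcard : T.card = 5 := by rw [hT, card_erase_of_mem hp, hD6card]
      have hTne : T.Nonempty := card_pos.1 (by omega)
      have hpT : p ∉ T := notMem_erase p D6
      have key := weighted_cycle_finset p T hTne hpT θ (fun _ => (0.525 : ℝ)) hθp hθ ?_
      · simp only [sum_const, hTcard, nsmul_eq_mul] at key
        norm_num at key
        linarith
      · intro u hu v hv huv x hx hcx
        rw [hT, insert_erase hp] at hu hv
        have huD := hD6 hu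
        have hvD := hD6 hv
        have huF := (hmemD u huD).1
        have hvF := (hmemD v hvD).1
        have hs := hpair ρ θ hρ hθpair u huF v hvF huv x hcx
        have := arc_gt_deep_deep 0.497 1.05 (1 / 2) (u 2) (v 2) (ρ u) (ρ v) x (by norm_num)
          cos_t6_gt (by linarith) (by norm_num) (by norm_num) (hmemD u huD).2 (hmemD v hvD).2
          (hρpos ρ hρ u huD) (hρpos ρ hρ v hvD) (hzρ ρ hρ u huF) (hzρ ρ hρ v hvF) hx hs
        show (0.525 : ℝ) + 0.525 < x
        linarith
    · /- exactly five deep directions, no pole, and a level direction -/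
      have hD5 : D.card = 5 := by omega
      have hLpos : 0 < L.card := by omega
      obtain ⟨ℓ, hℓ⟩ : L.Nonempty := card_pos.1 hLpos
      have hℓF := (hmemL ℓ hℓ).1
      have hℓz := (hmemL ℓ hℓ).2
      have hℓρ : 0 < ℓ 0 ^ 2 + ℓ 1 ^ 2 := by
        have h1 := (abs_le.1 hℓz).1; have h2 := (abs_le.1 hℓz).2
        nlinarith [hco ℓ hℓF]
      obtain ⟨ρ, θ, hρ, hθ, hθℓ, -, hθpair⟩ := exists_azimuth ℓ hℓρ
      obtain ⟨e, hmono⟩ := exists_sorted_equiv D θ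
      have hi : ∀ i, i < 5 → i < D.card := fun i h => by omega
      -- the five deep directions in azimuthal order (as an opaque sequence)
      obtain ⟨q, hqe⟩ : ∃ q : ℕ → EuclideanSpace ℝ (Fin 3),
          ∀ i (h : i < 5), q i = (e ⟨i, hi i h⟩ : EuclideanSpace ℝ (Fin 3)) :=
        ⟨fun i => if h : i < 5 then (e ⟨i, hi i h⟩ : EuclideanSpace ℝ (Fin 3)) else ℓ,
          fun i h => dif_pos h⟩
      have hqD : ∀ i, i < 5 → q i ∈ D := fun i h => by rw [hqe i h]; exact (e ⟨i, hi i h⟩).2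
      have hqF : ∀ i, i < 5 → q i ∈ F := fun i h => (hmemD _ (hqD i h)).1
      have hqz : ∀ i, i < 5 → q i 2 ≤ -(1 / 2) := fun i h => (hmemD _ (hqD i h)).2
      have hqρ : ∀ i, i < 5 → 0 < ρ (q i) := fun i h => hρpos ρ hρ _ (hqD i h)
      have hq1 : ∀ i, i < 5 → q i 2 ^ 2 + ρ (q i) ^ 2 = 1 := fun i h => hzρ ρ hρ _ (hqF i h)
      have hqne : ∀ i j, i < 5 → j < 5 → i ≠ j → q i ≠ q j := by
        intro i j hi5 hj5 hij heq
        rw [hqe i hi5, hqe j hj5] at heq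
        have := e.injective (Subtype.ext heq)
        simp at this; exact hij this
      have hqℓ : ∀ i, i < 5 → q i ≠ ℓ := fun i h heq =>
        hnotL _ (hqD i h) (by rw [heq]; exact hℓz)
      have hmono' : ∀ i j, i ≤ j → j < 5 → θ (q i) ≤ θ (q j) := by
        intro i j hij hj
        rw [hqe i (by omega), hqe j hj]
        exact hmono (show (⟨i, hi i (by omega)⟩ : Fin D.card) ≤ ⟨j, hi j hj⟩ by
          simp [Fin.le_def, hij])
      have hℓ1 : ℓ 2 ^ 2 + ρ ℓ ^ 2 = 1 := hzρ ρ hρ ℓ hℓF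
      -- separation facts
      have hsepq : ∀ i j, i < 5 → j < 5 → i ≠ j → ∀ x, Real.cos x = Real.cos (θ (q i) - θ (q j)) →
          ρ (q i) * ρ (q j) * Real.cos x + q i 2 * q j 2 ≤ 1 / 2 :=
        fun i j hi5 hj5 hij x hx =>
          hpair ρ θ hρ hθpair _ (hqF i hi5) _ (hqF j hj5) (hqne i j hi5 hj5 hij) x hx
      have hsepℓ : ∀ i, i < 5 → ∀ x, Real.cos x = Real.cos (θ (q i)) →
          ρ (q i) * ρ ℓ * Real.cos x + q i 2 * ℓ 2 ≤ 1 / 2 := by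
        intro i hi5 x hx
        refine hpair ρ θ hρ hθpair _ (hqF i hi5) ℓ hℓF (hqℓ i hi5) x ?_
        rw [hθℓ, sub_zero]; exact hx
      refine chain_five_deep_level_false (fun i => θ (q i)) (fun i => q i 2) hmono' (hθ _).1
        (hθ _).2 ?_ ?_ ?_ ?_ ?_
      · intro i j hi5 hj5 hij x hx hcx
        exact arc_gt_deep_deep 0.336 1.228 (1 / 2) (q i 2) (q j 2) (ρ (q i)) (ρ (q j)) x
          (by norm_num) cos_tdd_gt (by linarith) (by norm_num) (by norm_num) (hqz i hi5) (hqz j hj5)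
          (hqρ i hi5) (hqρ j hj5) (hq1 i hi5) (hq1 j hj5) hx (hsepq i j hi5 hj5 hij x hcx)
      · intro i j hi5 hj5 hij hz x hx hcx
        exact arc_gt_deep_deep 0.2554 1.3125 0.682 (q i 2) (q j 2) (ρ (q i)) (ρ (q j)) x
          (by norm_num) cos_taD_gt (by linarith) (by norm_num) (by norm_num) hz.le (hqz j hj5)
          (hqρ i hi5) (hqρ j hj5) (hq1 i hi5) (hq1 j hj5) hx (hsepq i j hi5 hj5 hij x hcx)
      · intro i j hi5 hj5 hij hz x hx hcx
        exact arc_gt_deep_deep 0.2923 1.2741 0.602 (q i 2) (q j 2) (ρ (q i)) (ρ (q j)) x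
          (by norm_num) cos_taM_gt (by linarith) (by norm_num) (by norm_num) hz.le (hqz j hj5)
          (hqρ i hi5) (hqρ j hj5) (hq1 i hi5) (hq1 j hj5) hx (hsepq i j hi5 hj5 hij x hcx)
      · intro i hi5 hz x hx hcx
        exact arc_gt_deep_level 0.7831 0.6702 0.682 (q i 2) (ℓ 2) (ρ (q i)) (ρ ℓ) x
          (by norm_num) cos_tCM_gt (by linarith) (by norm_num) (hqz i hi5) hz hℓz (hρ _).1 (hρ ℓ).1
          (hq1 i hi5) hℓ1 hx (hsepℓ i hi5 x hcx)
      · intro i hi5 hz x hx hcx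
        exact arc_gt_deep_level 0.7073 0.7837 0.602 (q i 2) (ℓ 2) (ρ (q i)) (ρ ℓ) x
          (by norm_num) cos_tCS_gt (by linarith) (by norm_num) (hqz i hi5) hz hℓz (hρ _).1 (hρ ℓ).1
          (hq1 i hi5) hℓ1 hx (hsepℓ i hi5 x hcx)

/-! ### The registered stub -/

/-- **Registered stub `stub_jointBound_deepHeavy` (line `joint-level-support-bound`).**  Deep-heavy
regime of the joint level/support bound: for a unit normal `ν` and a kissing-separated finite set `U`
of unit vectors, five or more `1/2`-deep directions force `2·#deep + #level(1/10) ≤ 12` (rows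
(≥ 7 deep), (6 deep, ≥ 1 level), (5 deep, ≥ 3 level) are empty).  Transport of
`jointBound_deepHeavy_coord` along an orthonormal frame with third vector `ν`. -/
theorem stub_jointBound_deepHeavy :
    ∀ ν : EuclideanSpace ℝ (Fin 3), ‖ν‖ = 1 → ∀ U : Finset (EuclideanSpace ℝ (Fin 3)),
      (∀ u ∈ U, ‖u‖ = 1) → (∀ u ∈ U, ∀ w ∈ U, u ≠ w → ⟪u, w⟫_ℝ ≤ 1 / 2) →
      5 ≤ (U.filter fun u => ⟪u, ν⟫_ℝ ≤ -(1 / 2)).card →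
      2 * (U.filter fun u => ⟪u, ν⟫_ℝ ≤ -(1 / 2)).card
        + (U.filter fun u => |⟪u, ν⟫_ℝ| ≤ 1 / 10).card ≤ 12 := by
  classical
  intro ν hν U hU hsep h5
  obtain ⟨b, hb⟩ := exists_orthonormalBasis_third_eq_unit hν
  have hcoord : ∀ u, (b.repr u : EuclideanSpace ℝ (Fin 3)) 2 = ⟪u, ν⟫_ℝ := fun u => by
    rw [show (b.repr u : EuclideanSpace ℝ (Fin 3)) 2 = ⟪b 2, u⟫_ℝ from b.repr_apply_apply u 2, hb,
      real_inner_comm]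
  have hinj : Function.Injective (fun u => (b.repr u : EuclideanSpace ℝ (Fin 3))) :=
    fun u w h => b.repr.injective h
  set F := U.image (fun u => (b.repr u : EuclideanSpace ℝ (Fin 3))) with hF
  have hdeep : (U.filter fun u => ⟪u, ν⟫_ℝ ≤ -(1 / 2)).card =
      (F.filter fun u => u 2 ≤ -(1 / 2)).card := by
    rw [hF, filter_image, card_image_of_injective _ hinj]
    congr 1
    exact filter_congr fun u _ => by simp only [hcoord]
  have hlevel : (U.filter fun u => |⟪u, ν⟫_ℝ| ≤ 1 / 10).card =
      (F.filter fun u => |u 2| ≤ 1 / 10).card := by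
    rw [hF, filter_image, card_image_of_injective _ hinj]
    congr 1
    exact filter_congr fun u _ => by simp only [hcoord]
  rw [hdeep] at h5
  rw [hdeep, hlevel]
  refine jointBound_deepHeavy_coord F ?_ ?_ h5
  · intro u hu
    obtain ⟨w, hw, rfl⟩ := mem_image.1 hu
    rw [LinearIsometryEquiv.norm_map]; exact hU w hw
  · intro u hu w hw huw
    obtain ⟨u', hu', rfl⟩ := mem_image.1 hu
    obtain ⟨w', hw', rfl⟩ := mem_image.1 hw
    rw [LinearIsometryEquiv.inner_map_map]
    exact hsep u' hu' w' hw' fun h => huw (by rw [h])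

end Summit.Ventures.Crystal3D.Theorems

end
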